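import Summits.BirchSwinnertonDyer.BirchSwinnertonDyer.Theorems.PrintX8VSCLowerDivisibilityContraOfKatoSporadic
import Summits.BirchSwinnertonDyer.BirchSwinnertonDyer.Theorems.PrintX8VSCSharpFlatMainConjectureContraOfLowerDivisibility
import Summits.BirchSwinnertonDyer.BirchSwinnertonDyer.Theorems.PrintX8VSCMuBoundSmallImageContra
import Summits.BirchSwinnertonDyer.BirchSwinnertonDyer.Theorems.PrintX8SharpFlatRankZeroRoadContra
import Summits.BirchSwinnertonDyer.BirchSwinnertonDyer.Theorems.ConjSpanGenAllLevels
import Summits.BirchSwinnertonDyer.BirchSwinnertonDyer.Theorems.PrintX8VSInputHondaSystemPrimalPadic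
import Summits.BirchSwinnertonDyer.BirchSwinnertonDyer.Theorems.PrintX8VSInputHondaSystemPrimalTransport
import Summits.BirchSwinnertonDyer.BirchSwinnertonDyer.Theorems.PrintX8VSInputHondaSystemDualClauses
import Literature.NumberTheory.Automorphic.CongruenceSubgroupPropertySL2AwayHolds
import HarnessLib

/-!
# Corner X8 (`p = 3`, good supersingular, `a₃ = ±3`), analytic rank `0` — the range on which route K3 `SignedLowerHalves` consumes
# the crux `SprungLowerDivisibilityAtThree` (stmt-BirchSwinnertonDyer-19875, HELD): **`BSD(E,3)` at every rank-zero X8 pair from the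
# BODIES of the two print-keyed cruxes K′ / C′ of route `PrintX8VSC` and NAMED PRINT FACTS ONLY** — no Gross–Zagier–Kolyvagin inside the
# Eisenstein half, no Kobayashi 2013 simple-zero fact, THEOREM B and Sprung 2012 Thm 2.2 discharged in-kernel

Cell `bsd-ssimc`, width seat `cruxlead-stmt-BirchSwinnertonDyer-19875-w2` (gen 11) under the 19875 LEAD; `--supports`
stmt-BirchSwinnertonDyer-19875 `--as helper`; THEOREMS ONLY; route-independent (no `Theses` import: the crux bodies `hKc` / `hCc` are
section hypotheses VERBATIM the consequents of `PrintX8VSC.KatoFineLowerSporadicGivenHeldX8Contra` (item 23732) /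
`PrintX8VSC.CyclotomicLowerPosLevelGivenHeldX8Contra` (item 23733) after their four fact antecedents). HONEST FRAMING: a CALIBRATION for the
K3 pen's TURNKEY #5 («re-draw crux 5's K1-input BY SIGNATURE against PrintX8VSC's C-keyed layer») and for the x8 rank-zero link: it composes
this seat's 23743-port (p675498 / p675769 / p676041) with w3 g10's print-keyed rank-zero road (p674964
`X8MainConjectureRoadContra.X8.bsdp_of_sprungSharpFlatMainConjectureContra_of_analyticRank_eq_zero`). Nothing new is proved about the cruxes:
K′ and C′ (Kato 12.10 ⊆ at the sporadic common zeros / Sprung 7.21 ⊆ at the positive-level cyclotomic common zeros, `a₃ = ±3`) are OPEN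
IN PRINT and enter as hypotheses; `BSD(E,3)` on X8, the leaf and BSD are NOT proved. Referee N-287b honoured (no γ-fact at γ⁻¹).

* §1 `ChromaticCommonZeros.lowerDivisibilityContra_of_katoSporadic_of_posLevel_of_analyticRank_eq_zero` — at `r_an = 0` the
  print-keyed Eisenstein half on every contragredient datum from `hKc ∧ hCc ∧ h714 ∧ h3 ∧ hJc` ONLY (twin of p620968 §3: at analytic
  rank zero every Néron-normalised colour has non-zero constant term, `ChromaticCommonZerosRankZero.normalised_notMem_of_X_mem`, so `(T)` is
  never a common zero and the `(T)`-brick — GZK, Kobayashi 2013 Cor. 1.3 (i), control — is not invoked).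
* §2 `X8MainConjectureContra.sharpFlatMainConjectureContra_of_cruxBodies_of_analyticRank_eq_zero` — + Thm 7.16 print-keyed (`h716c`) ⟹
  the print-keyed main identity on EVERY datum, every colour, at the rank-zero pair: `surj(3)` by p675498 §2, `¬ surj(3)` by the THEOREM-B
  `μ`-bound (p675769, THEOREM B DISCHARGED here from the route-independent kernel theorem
  `ConjSpanGenAllLevels.conjSpanGenAll_of_vaserstein_away SL2Rel.Away.relG_le_relE_span_natCast`) + p675498 §3.
* §3 `X8MainConjectureContra.X8.bsdp_of_cruxBodiesContra_of_analyticRank_eq_zero` — + modularity (`exists_isNewformOf`,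
  `hasEntireLFunction_rat`), Sprung 2024 Lemma 5.9 all-N (`h59`, a KERNEL THEOREM elsewhere:
  `SharpFlatCount.lem59AllN_sharpFlatCharValue_rankZero_holds`, displayed here only to keep this file off the `SignedLowerHalves` theses
  cone) and GZK (rank `0` from analytic rank `0`, Kolyvagin) ⟹ `BSDp W 3`, through w3 g10's road; Sprung 2012 Thm 2.2 (Honda systems)
  DISCHARGED in-kernel (`SprungHonda.*`, the proof of `thm22_exists_isHondaSystem_holds` re-run route-free). Class form §4.

NET DISPLAYED TRUST BASE of «BSD(E,3) on X8 ∩ {r_an = 0}» after this file: K′-body, C′-body (research) + {Sprung 2012 Thm 7.14, Thm 7.16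
(print key), period unit at 3 (⟸ Mazur Cor 4.1), the JOINT contragredient Coleman–Kato package, modularity ×2, Sprung 2024 Lem 5.9 (kernel),
GZK} — and, to OBTAIN the bodies from the items, their guard {7.14, 7.16c, period} + ι-door pack {PT functional model, Kato 12.4, Matar 1.1}.

References: [Kato2004Asterisque] Conj. 12.10 (p. 224), Thm. 12.5/12.6 (p. 222), §17.13 (p. 280); [Sprung2012] Thm. 2.2 (p. 1487), Prop.
6.14 (p. 1498), Thm. 7.14, Thm. 7.16 (p. 1504), Prop. 7.19 and Main Conj. 7.21 (p. 1505), §7.5 l.1; [Sprung2024] §5.2, Thm. 5.3;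
[Pollack2003] Def. 6.15; [Wuthrich2014] Lemma 20; [Vaserstein1972SL2] Theorem; [Manin1972] Prop. 1.4; [Miller2011LMS] Def. 1.1;
[Kolyvagin1990] Thm. A; [GrossZagier1986] Thm. (7.3).
-/

set_option linter.dupNamespace false
set_option autoImplicit false

noncomputable section

open scoped Classical NumberField MatrixGroups ModularForm

open NumberField IsDedekindDomain CongruenceSubgroup WeierstrassCurve Field
  Literature.NumberTheory.EllipticCurves Literature.NumberTheory.EllipticCurves.ModularForms
  Literature.NumberTheory.EllipticCurves.ZpExtension Literature.NumberTheory.EllipticCurves.Sprung2017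
  Literature.NumberTheory.EllipticCurves.Sprung2012 Literature.NumberTheory.EllipticCurves.Rank1Residual
  Literature.NumberTheory.EllipticCurves.IwasawaAlgebra Literature.NumberTheory.EllipticCurves.Kato2004
  Literature.NumberTheory.EllipticCurves.Module Literature.NumberTheory.EllipticCurves.Sprung2024
  Summit.BirchSwinnertonDyer.BirchSwinnertonDyer.Theorems
  Summit.BirchSwinnertonDyer.BirchSwinnertonDyer.Theorems.SmallImageSignedMuDefect
  Summit.BirchSwinnertonDyer.Rank1Residual.Supersingular

namespace Summit.BirchSwinnertonDyer.BirchSwinnertonDyer.Theorems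

section CruxBodies

-- The bodies of the two print-keyed cruxes (PrintX8VSC items 23732 / 23733 after their four fact antecedents), VERBATIM (as in
-- `PrintX8VSCLowerDivisibilityContraOfKatoSporadic`), as section hypotheses.
variable
  (hKc :
    ∀ (W : WeierstrassCurve ℚ) [W.IsElliptic] [W.IsGloballyMinimal] (p : ℕ) [Fact p.Prime]
      [ContinuousSMul ℤ_[p] (W.tateModule p)] [Module.Free ℤ_[p] (W.tateModule p)]
      [Module.Finite ℤ_[p] (W.tateModule p)],
      ClassX8 W p → ∀ (κ : ZpExtension ℚ p) (γ : Field.absoluteGaloisGroup ℚ),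
      κ.IsCyclotomic → κ.IsTopGenerator γ → IsCyclotomicVariable p γ →
    ∀ (v : HeightOneSpectrum (𝓞 ℚ)), (p : 𝓞 ℚ) ∈ v.asIdeal →
    ∀ (g : Field.absoluteGaloisGroup (v.adicCompletion ℚ)),
      κ.IsTopGenerator (resGalOfEmb (closureEmb (K := ℚ) (v.adicCompletion ℚ)) g) →
    ∀ (cneg : localPoints W (v.adicCompletion ℚ)) (c : ℕ → localPoints W (v.adicCompletion ℚ)),
      IsHondaSystem κ (closureEmb (K := ℚ) (v.adicCompletion ℚ)) W (W.frobeniusTrace p) g cneg c →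
    ∀ (N : ℕ) (_ : NeZero N) (f : CuspForm (Gamma0 N) 2) (ϖ : ℚ) (Lsharp Lflat : IwasawaAlgebra p),
      IsNewformOf W f → (ϖ : ℝ) * W.realPeriodRat = plusPeriod f →
      IsSprungPair f p (W.frobeniusTrace p) Lsharp Lflat →
    ∀ (I : Kato2004.IwasawaH1Data W p κ γ)
      (Cs : SharpFlatColemanKatoDataContra W p f ϖ κ γ (closureEmb (K := ℚ) (v.adicCompletion ℚ))
        (W.frobeniusTrace p) g c Chroma.sharp I)
      (Cf : SharpFlatColemanKatoDataContra W p f ϖ κ γ (closureEmb (K := ℚ) (v.adicCompletion ℚ))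
        (W.frobeniusTrace p) g c Chroma.flat I),
      Cs.Z = Cf.Z →
    ∀ (Y : W.FineSelmerDualData κ γ⁻¹) (𝔭 : PrimeSpectrum (IwasawaAlgebra p)), 𝔭.asIdeal.height = 1 →
      (p : IwasawaAlgebra p) ∉ 𝔭.asIdeal →
      (¬ ∃ n : ℕ, ((cyclotomicOmega p n).map (Int.castRingHom ℤ_[p]) : PowerSeries ℤ_[p]) ∈ 𝔭.asIdeal) →
      (∀ (col' : Chroma) (G' : IwasawaAlgebra p),
        iwasawaToPowerSeries p G' =
          PowerSeries.C (ϖ : ℚ_[p]) * iwasawaToPowerSeries p (chromaticL col' Lsharp Lflat) →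
        G' ∈ 𝔭.asIdeal) →
      Module.lengthAt (IwasawaAlgebra p) (I.H ⧸ Cs.Z) 𝔭 ≤ Module.lengthAt (IwasawaAlgebra p) Y.X 𝔭)
  (hCc :
    ∀ (W : WeierstrassCurve ℚ) [W.IsElliptic] [W.IsGloballyMinimal] (p : ℕ) [Fact p.Prime]
      [ContinuousSMul ℤ_[p] (W.tateModule p)] [Module.Free ℤ_[p] (W.tateModule p)]
      [Module.Finite ℤ_[p] (W.tateModule p)],
      ClassX8 W p → ∀ (col : Chroma) (κ : ZpExtension ℚ p) (γ : Field.absoluteGaloisGroup ℚ),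
      κ.IsCyclotomic → κ.IsTopGenerator γ → IsCyclotomicVariable p γ →
    ∀ (v : HeightOneSpectrum (𝓞 ℚ)), (p : 𝓞 ℚ) ∈ v.asIdeal →
    ∀ (g : Field.absoluteGaloisGroup (v.adicCompletion ℚ)),
      κ.IsTopGenerator (resGalOfEmb (closureEmb (K := ℚ) (v.adicCompletion ℚ)) g) →
    ∀ (cneg : localPoints W (v.adicCompletion ℚ)) (c : ℕ → localPoints W (v.adicCompletion ℚ)),
      IsHondaSystem κ (closureEmb (K := ℚ) (v.adicCompletion ℚ)) W (W.frobeniusTrace p) g cneg c →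
    ∀ (N : ℕ) (_ : NeZero N) (f : CuspForm (Gamma0 N) 2) (ϖ : ℚ) (Lsharp Lflat : IwasawaAlgebra p),
      IsNewformOf W f → (ϖ : ℝ) * W.realPeriodRat = plusPeriod f →
      IsSprungPair f p (W.frobeniusTrace p) Lsharp Lflat → chromaticL col Lsharp Lflat ≠ 0 →
    ∀ (D : SharpFlatSelmerDualData W κ γ⁻¹ (closureEmb (K := ℚ) (v.adicCompletion ℚ))
        (W.frobeniusTrace p) g c col) [Module.Finite (IwasawaAlgebra p) D.X],
      Module.IsTorsion (IwasawaAlgebra p) D.X →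
    ∀ (G : IwasawaAlgebra p),
      iwasawaToPowerSeries p G =
        PowerSeries.C (ϖ : ℚ_[p]) * iwasawaToPowerSeries p (chromaticL col Lsharp Lflat) →
    ∀ (I : Kato2004.IwasawaH1Data W p κ γ)
      (Cs : SharpFlatColemanKatoDataContra W p f ϖ κ γ (closureEmb (K := ℚ) (v.adicCompletion ℚ))
        (W.frobeniusTrace p) g c Chroma.sharp I)
      (Cf : SharpFlatColemanKatoDataContra W p f ϖ κ γ (closureEmb (K := ℚ) (v.adicCompletion ℚ))
        (W.frobeniusTrace p) g c Chroma.flat I),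
      Cs.Z = Cf.Z →
    ∀ 𝔭 : PrimeSpectrum (IwasawaAlgebra p), 𝔭.asIdeal.height = 1 →
      (PowerSeries.X : IwasawaAlgebra p) ∉ 𝔭.asIdeal →
      (∃ j : ℕ, 1 ≤ j ∧
        ((((Polynomial.cyclotomic (p ^ j) ℤ).comp (Polynomial.X + 1)).map (Int.castRingHom ℤ_[p]) : Polynomial ℤ_[p]) :
          PowerSeries ℤ_[p]) ∈ 𝔭.asIdeal) →
      (∀ (col' : Chroma) (G' : IwasawaAlgebra p),
        iwasawaToPowerSeries p G' =
          PowerSeries.C (ϖ : ℚ_[p]) * iwasawaToPowerSeries p (chromaticL col' Lsharp Lflat) →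
        G' ∈ 𝔭.asIdeal) →
      Module.lengthAt (IwasawaAlgebra p) (IwasawaAlgebra p ⧸ Ideal.span {G}) 𝔭 ≤
        Module.lengthAt (IwasawaAlgebra p) D.X 𝔭)

include hKc hCc

/-! ### §1 The print-keyed Eisenstein half at analytic rank ZERO — no GZK, no Kobayashi 2013 -/

/-- **The Eisenstein half in PRINT keying on every contragredient datum, at an X8 pair with `r_an = 0`, from the bodies of K′ (`hKc`) and
C′ (`hCc`) and `h714 ∧ h3 ∧ hJc` ONLY.** At analytic rank zero every Néron-normalised `G^•` has non-zero constant term (Sprung 2012 Prop. 6.14;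
`ChromaticCommonZerosRankZero.normalised_notMem_of_X_mem`), so a common height-one zero never contains `T`: the case analysis of
`lowerDivisibilityContra_of_katoSporadic_of_posLevel_of_analyticRank_le_one` (p676041) loses its `(T)`-branch and with it Gross–Zagier–Kolyvagin,
Kobayashi 2013 Cor. 1.3 (i) and the control theorem. The `γ⁻¹`-keyed twin of p620968 §3. CONDITIONAL (displayed: `h714` Sprung 2012 Thm. 7.14,
`h3` the period unit at `3`, `hJc` the γ⁻¹-keyed joint ♯/♭ Coleman–Kato package); closes nothing.
[cite: Kato2004Asterisque, Conj. 12.10 (p. 224) and §17.13 (p. 280)] [cite: Sprung2012, Prop. 6.14 (p. 1498), Thm. 7.14 (p. 1504), Prop. 7.19 and Main Conj. 7.21 (p. 1505)] -/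
theorem ChromaticCommonZeros.lowerDivisibilityContra_of_katoSporadic_of_posLevel_of_analyticRank_eq_zero
    (h714 : thm714_sharpFlatSelmerDual_finite_torsion) (h3 : realPeriodRat_eq_unit_mul_plusPeriod_three)
    (hJc : thm714seq_sharpFlatColemanKato_zetaJoint_contra)
    (W : WeierstrassCurve ℚ) [W.IsElliptic] [W.IsGloballyMinimal] (p : ℕ) [Fact p.Prime] (hX : ClassX8 W p)
    (h0 : W.analyticRank = 0) (col : Chroma) :
    ∀ (κ : ZpExtension ℚ p) (γ : Field.absoluteGaloisGroup ℚ),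
        κ.IsCyclotomic → κ.IsTopGenerator γ → IsCyclotomicVariable p γ →
      ∀ (v : HeightOneSpectrum (𝓞 ℚ)), (p : 𝓞 ℚ) ∈ v.asIdeal →
      ∀ (g : Field.absoluteGaloisGroup (v.adicCompletion ℚ)),
        κ.IsTopGenerator (resGalOfEmb (closureEmb (K := ℚ) (v.adicCompletion ℚ)) g) →
      ∀ (cneg : localPoints W (v.adicCompletion ℚ)) (c : ℕ → localPoints W (v.adicCompletion ℚ)),
        IsHondaSystem κ (closureEmb (K := ℚ) (v.adicCompletion ℚ)) W (W.frobeniusTrace p) g cneg c →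
      ∀ (N : ℕ) (_ : NeZero N) (f : CuspForm (Gamma0 N) 2) (ϖ : ℚ) (Lsharp Lflat : IwasawaAlgebra p),
        IsNewformOf W f → (ϖ : ℝ) * W.realPeriodRat = plusPeriod f →
        IsSprungPair f p (W.frobeniusTrace p) Lsharp Lflat → chromaticL col Lsharp Lflat ≠ 0 →
      ∀ D' : SharpFlatSelmerDualData W κ γ⁻¹ (closureEmb (K := ℚ) (v.adicCompletion ℚ))
          (W.frobeniusTrace p) g c col,
        ∃ gen h : IwasawaAlgebra p, D'.charIdeal = Ideal.span {gen} ∧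
          iwasawaToPowerSeries p gen =
            PowerSeries.C (ϖ : ℚ_[p]) * iwasawaToPowerSeries p (chromaticL col Lsharp Lflat * h) := by
  intro κ γ hκ hγ hcv v hv g hg cneg c hH N hN f ϖ Lsharp Lflat hf hϖ hSP hcol D'
  classical
  haveI : NeZero N := hN
  obtain ⟨hp3, ⟨hgood, hap⟩, -⟩ := id hX
  subst hp3
  haveI : ContinuousSMul ℤ_[3] (W.tateModule 3) := TateModule.continuousSMul_padicInt
  haveI : Module.Free ℤ_[3] (W.tateModule 3) := W.module_free_tateModule_holds 3
  haveI : Module.Finite ℤ_[3] (W.tateModule 3) := W.module_finite_tateModule_holds 3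
  have hp2 : (3 : ℕ) ≠ 2 := by decide
  have hirr : W.HasIrreducibleModPGaloisRep 3 :=
    hasIrreducibleModPGaloisRep_of_dvd_frobeniusTrace W 3 hp2
      (W.not_dvd_minimalDiscriminantInt_of_hasGoodReductionAtPrime' 3 hgood) hap
  -- Thm. 7.14 (keying-immune) transported to the contragredient datum of colour `•`
  obtain ⟨D₀⟩ := nonempty_sharpFlatSelmerDualData_rat W κ γ v g c col
  obtain ⟨hfin₀, htor₀⟩ :=
    h714 W 3 hp2 hgood hap f hf κ γ hκ hγ hcv v hv g hg cneg c hH col Lsharp Lflat hSP hcol D₀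
  haveI := hfin₀
  haveI : Module.Finite (IwasawaAlgebra 3) D'.X := (sharpFlatSelmerDualData_finite_inv_iff D₀ D').1 hfin₀
  have htorD : Module.IsTorsion (IwasawaAlgebra 3) D'.X := (sharpFlatSelmerDualData_isTorsion_inv_iff D₀ D').1 htor₀
  -- the pinned covariant `𝐇¹`, the print-keyed joint package and a `γ⁻¹`-keyed fine datum
  obtain ⟨I⟩ := Kato2004.nonempty_iwasawaH1Data_holds W 3 κ γ hκ hγ
  obtain ⟨Cs, Cf, hZ⟩ := hJc W 3 f ϖ κ γ hp2 hgood hap hf hϖ hκ hγ hcv v hv g hg cneg c hH I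
  obtain ⟨Y⟩ := W.nonempty_fineSelmerDualData' (κ := κ) γ⁻¹
  -- S3: a colour `col₀` with normalised `G₀ ∉ (3)`
  obtain ⟨-, col₀, G₀, hG₀, hμ⟩ := ChromaticCommonZeros.stub_periodMu h3 W 3 hX N hN f ϖ Lsharp Lflat hf hϖ hSP
  -- the Néron-normalised `G = C(u)·L^•`
  have hϖ1 : ‖(ϖ : ℚ_[3])‖ = 1 := ChromaticCommonZeros.norm_periodRatio_eq_one_of_classX8 h3 W 3 hX f hf ϖ hϖ
  set u : ℤ_[3]ˣ := PadicInt.mkUnits hϖ1 with hu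
  set G : IwasawaAlgebra 3 := PowerSeries.C (u : ℤ_[3]) * chromaticL col Lsharp Lflat with hGdef
  have hG : iwasawaToPowerSeries 3 G =
      PowerSeries.C (ϖ : ℚ_[3]) * iwasawaToPowerSeries 3 (chromaticL col Lsharp Lflat) := by
    rw [hGdef, (span_C_units_mul_eq u (chromaticL col Lsharp Lflat)).2, hu, PadicInt.mkUnits_eq]
  have hG0 : G ≠ 0 := mul_ne_zero (((Units.isUnit u).map PowerSeries.C).ne_zero) hcol
  refine ChromaticCommonZeros.squeezeToCommonZeros_contra W 3 hX col κ γ hκ hγ hcv v hv g hg cneg c hH N hN f ϖ Lsharp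
    Lflat hf hϖ hSP hcol D' htorD G hG I Cs Cf hZ ?_
  intro 𝔭 h𝔭 hcommon
  -- `(3)` is not a common zero: colour `col₀` has unit content and `|ϖ|₃ = 1`
  have hp𝔭 : ((3 : ℕ) : IwasawaAlgebra 3) ∉ 𝔭.asIdeal := fun hp => hμ 𝔭 h𝔭 hp (hcommon col₀ G₀ hG₀)
  -- `(T)` is not a common zero at `r_an = 0`: `G(0) ≠ 0`
  have hT : (PowerSeries.X : IwasawaAlgebra 3) ∉ 𝔭.asIdeal := fun hT =>
    ChromaticCommonZerosRankZero.normalised_notMem_of_X_mem W 3 hX h0 hf hϖ hSP col hG 𝔭 h𝔭 hT (hcommon col G hG)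
  by_cases hcyc :
      ∃ n : ℕ, ((cyclotomicOmega 3 n).map (Int.castRingHom ℤ_[3]) : PowerSeries ℤ_[3]) ∈ 𝔭.asIdeal
  · -- a cyclotomic common zero, necessarily of positive level: C′'s body
    obtain ⟨n, hω⟩ := hcyc
    obtain ⟨j, hj1, -, hΦ⟩ := ChromaticCommonZerosRankZero.exists_cyclotomic_comp_mem_of_omega_mem 3 𝔭 n hω hT
    exact hCc W 3 hX col κ γ hκ hγ hcv v hv g hg cneg c hH N hN f ϖ Lsharp Lflat hf hϖ hSP hcol D' htorD G hG I
      Cs Cf hZ 𝔭 h𝔭 hT ⟨j, hj1, hΦ⟩ hcommon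
  · -- sporadic common zero: K′'s body, moved to the guard colour by `SharpFlatColemanKatoDataContra.eisenstein_iff_fine`
    have hK := hKc W 3 hX κ γ hκ hγ hcv v hv g hg cneg c hH N hN f ϖ Lsharp Lflat hf hϖ hSP I Cs Cf hZ Y
      𝔭 h𝔭 hp𝔭 hcyc hcommon
    cases col with
    | sharp => exact (Cs.eisenstein_iff_fine W 3 hirr hSP hcol hG hG0 D' htorD Y 𝔭 h𝔭).mpr hK
    | flat =>
      rw [hZ] at hK
      exact (Cf.eisenstein_iff_fine W 3 hirr hSP hcol hG hG0 D' htorD Y 𝔭 h𝔭).mpr hK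

/-! ### §2 The print-keyed ♯/♭ main identity on every datum at a rank-zero X8 pair (THEOREM B discharged in-kernel) -/

/-- **X8 ∧ `r_an = 0`, ANY image: the bodies of K′/C′ + `h714`, `h716c` (Sprung 2012 Thm. 7.16 print-keyed), `h3`, `hJc` ⟹ the print-keyed
♯/♭ main identity** — `D.X` torsion and `char D.X = (gen)`, `gen^ℚ = ϖ·L^•^ℚ` — **for EVERY colour `•` with `L^• ≠ 0`, every
cyclotomic/Honda/newform/period/Sprung-pair instance and every `γ⁻¹`-keyed datum `D`** (the hypothesis `hMC` of w3 g10's rank-zero road).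
§1 ∘ (`surj(3)`: `X8MainConjectureContra.sharpFlatMainConjectureContra_of_lowerDivisibilityContra_of_surj`; `¬ surj(3)`: the `μ`-bound
`X8MainConjectureContra.muBoundSmallImageContra_of_conjSpanGen_of_zetaJoint` with THEOREM B supplied by the route-independent kernel theorem
`ConjSpanGenAllLevels.conjSpanGenAll_of_vaserstein_away SL2Rel.Away.relG_le_relE_span_natCast`, then `…_of_muInvariant_le`). CONDITIONAL
(displayed); closes nothing. [cite: Sprung2012, Thm. 7.14, Thm. 7.16 (p. 1504) and Main Conj. 7.21 (p. 1505)] [cite: Pollack2003, Def. 6.15]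
[cite: Vaserstein1972SL2, Theorem (p. 313)] [cite: Wuthrich2014, Lemma 20 (p. 399)] -/
theorem X8MainConjectureContra.sharpFlatMainConjectureContra_of_cruxBodies_of_analyticRank_eq_zero
    (h714 : thm714_sharpFlatSelmerDual_finite_torsion) (h716c : thm716_sharpFlatCharIdeal_divisibility_contra)
    (h3 : realPeriodRat_eq_unit_mul_plusPeriod_three) (hJc : thm714seq_sharpFlatColemanKato_zetaJoint_contra)
    (W : WeierstrassCurve ℚ) [W.IsElliptic] [W.IsGloballyMinimal] (p : ℕ) [Fact p.Prime] (hX : ClassX8 W p)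
    (h0 : W.analyticRank = 0) :
    ∀ (col : Chroma) (κ : ZpExtension ℚ p) (γ : Field.absoluteGaloisGroup ℚ),
      κ.IsCyclotomic → κ.IsTopGenerator γ → IsCyclotomicVariable p γ →
      ∀ (v : HeightOneSpectrum (𝓞 ℚ)), (p : 𝓞 ℚ) ∈ v.asIdeal →
      ∀ (g : Field.absoluteGaloisGroup (v.adicCompletion ℚ)),
        κ.IsTopGenerator (resGalOfEmb (closureEmb (K := ℚ) (v.adicCompletion ℚ)) g) →
      ∀ (cneg : localPoints W (v.adicCompletion ℚ)) (c : ℕ → localPoints W (v.adicCompletion ℚ)),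
        IsHondaSystem κ (closureEmb (K := ℚ) (v.adicCompletion ℚ)) W (W.frobeniusTrace p) g cneg c →
      ∀ (N : ℕ) (_ : NeZero N) (f : CuspForm (Gamma0 N) 2) (ϖ : ℚ) (Lsharp Lflat : IwasawaAlgebra p),
        IsNewformOf W f → (ϖ : ℝ) * W.realPeriodRat = plusPeriod f →
        IsSprungPair f p (W.frobeniusTrace p) Lsharp Lflat → chromaticL col Lsharp Lflat ≠ 0 →
      ∀ (D : SharpFlatSelmerDualData W κ γ⁻¹ (closureEmb (K := ℚ) (v.adicCompletion ℚ))
          (W.frobeniusTrace p) g c col),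
        Module.IsTorsion (IwasawaAlgebra p) D.X ∧
        ∃ gen : IwasawaAlgebra p, D.charIdeal = Ideal.span {gen} ∧
          iwasawaToPowerSeries p gen =
            PowerSeries.C (ϖ : ℚ_[p]) * iwasawaToPowerSeries p (chromaticL col Lsharp Lflat) := by
  intro col κ γ hκ hγ hcv v hv g hg cneg c hH N hN f ϖ Lsharp Lflat hf hϖ hSP hcol D
  haveI : NeZero N := hN
  -- §1: the print-keyed Eisenstein half on `D`
  have hlow := ChromaticCommonZeros.lowerDivisibilityContra_of_katoSporadic_of_posLevel_of_analyticRank_eq_zero hKc hCc h714 h3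
    hJc W p hX h0 col κ γ hκ hγ hcv v hv g hg cneg c hH N hN f ϖ Lsharp Lflat hf hϖ hSP hcol D
  by_cases hs : Surj W p
  · exact X8MainConjectureContra.sharpFlatMainConjectureContra_of_lowerDivisibilityContra_of_surj W p h714 h716c h3 hX hs
      col hκ hγ hcv hv hg hH hf hϖ hSP hcol D hlow
  · -- THEOREM B, route-independent kernel theorem (Vaserstein over `ℤ[1/m]`)
    have hSpan : ∀ (N p : ℕ), p.Prime → ¬ p ∣ N → ConjSpanGen N p :=
      ConjSpanGenAllLevels.conjSpanGenAll_of_vaserstein_away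
        Literature.NumberTheory.Automorphic.SL2Rel.Away.relG_le_relE_span_natCast
    exact X8MainConjectureContra.sharpFlatMainConjectureContra_of_lowerDivisibilityContra_of_muInvariant_le W p h714
      h716c h3 hX col hκ hγ hcv hv hg hH hf hϖ hSP hcol D hlow
      (X8MainConjectureContra.muBoundSmallImageContra_of_conjSpanGen_of_zetaJoint hSpan hJc h3 W p hX hs col κ γ hκ
        hγ hcv v hv g hg cneg c hH N hN f ϖ Lsharp Lflat hf hϖ hSP hcol D)

/-! ### §3 `BSD(E,3)` at every rank-zero X8 pair from the crux bodies and named print facts -/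

/-- **X8 ∧ `r_an = 0`, ANY image, ANY conductor: the bodies of K′/C′ + named PRINT facts ⟹ Miller's `BSD(E,3)` (`BSDp W 3`).** Inputs BY
NAME: Sprung 2012 Thm. 7.14 (`h714`), Thm. 7.16 print-keyed (`h716c`), the period unit at `3` (`h3`), the γ⁻¹-keyed joint Coleman–Kato package
(`hJc`), modularity (`hmodf` newform, `hmod` entire `L`), Sprung 2024 Lemma 5.9 all levels (`h59` — a KERNEL THEOREM,
`SharpFlatCount.lem59AllN_sharpFlatCharValue_rankZero_holds`, displayed only to stay off the `SignedLowerHalves` theses cone), GZK (`hGZK`: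
rank `0` from analytic rank `0`). DISCHARGED in-kernel: Sprung 2012 Thm. 2.2 (Honda systems: `SprungHonda.*`, the proof of
`thm22_exists_isHondaSystem_holds` re-run route-free) and THEOREM B (§2). Composition: §2 ⟶ w3 g10's print-keyed rank-zero road
`X8MainConjectureRoadContra.X8.bsdp_of_sprungSharpFlatMainConjectureContra_of_analyticRank_eq_zero` (p674964). CONDITIONAL on the crux bodies
(OPEN in print); closes nothing. [cite: Sprung2024, Thm. 5.3 (p. 38) and §5.2 (pp. 39–41)] [cite: Sprung2012, Thm. 2.2 (p. 1487), Thm. 7.14, Thm. 7.16, Main Conj. 7.21]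
[cite: Miller2011LMS, Def. 1.1] [cite: Kolyvagin1990, Thm. A] [cite: GrossZagier1986, Thm. (7.3)] -/
theorem X8MainConjectureContra.X8.bsdp_of_cruxBodiesContra_of_analyticRank_eq_zero
    (h714 : thm714_sharpFlatSelmerDual_finite_torsion) (h716c : thm716_sharpFlatCharIdeal_divisibility_contra)
    (h3 : realPeriodRat_eq_unit_mul_plusPeriod_three) (hJc : thm714seq_sharpFlatColemanKato_zetaJoint_contra)
    (hmodf : exists_isNewformOf) (h59 : lem59AllN_sharpFlatCharValue_rankZero)
    (hGZK : rank_eq_analyticRank_of_analyticRank_le_one) (hmod : hasEntireLFunction_rat)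
    (W : WeierstrassCurve ℚ) [W.IsElliptic] [W.IsGloballyMinimal] (p : ℕ) [Fact p.Prime] (hX : ClassX8 W p)
    (h0 : W.analyticRank = 0) : BSDp W p := by
  -- Sprung 2012 Thm. 2.2 (Honda systems), route-free kernel proof (as `thm22_exists_isHondaSystem_holds`)
  have h22 : thm22_exists_isHondaSystem := by
    intro W _ _ p _ hp2 hgood hap κ γ hκ _ _ v hv g hg
    obtain ⟨cneg, c, N, hN, hcneg, hc, hR0, hR1, hRn, hGEN, hGEN0⟩ :=
      SprungHonda.primalHonda_adicCompletion_of_padic W κ (W.frobeniusTrace p) v hv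
        (fun ι ↦ SprungHonda.exists_primalHonda_padic W hp2 hgood hap κ hκ ι)
    exact ⟨cneg, c, SprungHonda.isHondaSystem_of_primal κ (closureEmb (K := ℚ) (v.adicCompletion ℚ)) W
      (SprungHonda.intCast_sub_two_isUnit_of_dvd hp2 hap).2 hg hN hcneg hc hR0 hR1 hRn hGEN hGEN0⟩
  exact X8MainConjectureRoadContra.X8.bsdp_of_sprungSharpFlatMainConjectureContra_of_analyticRank_eq_zero hmodf h22 h714 h59
    h3 hGZK hmod W p hX h0
    (X8MainConjectureContra.sharpFlatMainConjectureContra_of_cruxBodies_of_analyticRank_eq_zero hKc hCc h714 h716c h3 hJc W p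
      hX h0)

/-! ### §4 Class form -/

/-- **CLASS FORM: `BSD(E,3)` at EVERY X8 pair of analytic rank `0` from the bodies of the two print-keyed cruxes K′/C′ of route `PrintX8VSC`
and named print facts** — the rank-zero range on which route K3 `SignedLowerHalves` (crux 5 `SprungLowerHalfAtThree`) consumes the HELD crux
19875; displayed trust base: {Sprung 2012 Thm. 7.14, Thm. 7.16 print-keyed, period unit at 3, γ⁻¹-keyed joint Coleman–Kato package,
modularity ×2, Sprung 2024 Lem. 5.9 (kernel theorem elsewhere), GZK}; NO Kobayashi 2013 Cor. 1.3 (i), THEOREM B and Thm. 2.2 discharged.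
CONDITIONAL on the crux bodies (OPEN in print at `a₃ = ±3`); closes nothing; BSD is not proved by this.
[cite: Sprung2024, Thm. 5.3 (p. 38)] [cite: Sprung2012, Main Conj. 7.21 (p. 1505)] [cite: Kato2004Asterisque, Conj. 12.10 (p. 224)] [cite: Miller2011LMS, Def. 1.1] -/
theorem X8MainConjectureContra.bsdp_rankZero_of_cruxBodiesContra
    (h714 : thm714_sharpFlatSelmerDual_finite_torsion) (h716c : thm716_sharpFlatCharIdeal_divisibility_contra)
    (h3 : realPeriodRat_eq_unit_mul_plusPeriod_three) (hJc : thm714seq_sharpFlatColemanKato_zetaJoint_contra)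
    (hmodf : exists_isNewformOf) (h59 : lem59AllN_sharpFlatCharValue_rankZero)
    (hGZK : rank_eq_analyticRank_of_analyticRank_le_one) (hmod : hasEntireLFunction_rat) :
    ∀ (W : WeierstrassCurve ℚ) [W.IsElliptic] [W.IsGloballyMinimal] (p : ℕ) [Fact p.Prime],
      ClassX8 W p → W.analyticRank = 0 → BSDp W p :=
  fun W _ _ p _ hX h0 =>
    X8MainConjectureContra.X8.bsdp_of_cruxBodiesContra_of_analyticRank_eq_zero hKc hCc h714 h716c h3 hJc hmodf h59 hGZK hmod
      W p hX h0

end CruxBodies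

end Summit.BirchSwinnertonDyer.BirchSwinnertonDyer.Theorems

end
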